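import Summits.QuantumFields.BalabanUV.Beta.GAN24.SymbolProjector

/-!
# `BalabanUV.Beta.GAN24.SymbolRate` — binder row G-an2-4 / (CONV-C), road P1-fibre, self-row P1-L11b1-pre (the `T00`-independent
# symbol-level half of typer row P1-L11b1 `BlockRateT`, node N17a; Part B, step B3 (i) of `SKELETON-P1.md`): TWO-LEVEL RATES of the
# per-alias-label T-block symbols `N²L_m`, `(N²L_m)⁻¹`, `Π⊥_m`, `Π⊥_m/(2N²L_m)` and the first-order (phase) structure of `N∂_m`

NOT IN PRINT; OUR PROOF ATTEMPT.  HONEST FRAMING (cell contract, verbatim): «discharging `BetaPertH` makes Bałaban's UV stability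
UNCONDITIONAL — a real constructive-QFT result; it is NOT the continuum limit and NOT the Clay problem.»  HONEST DEPENDENCY (verbatim):
«continuum YM on T⁴ ⇐ BetaPertH ∧ nine spine estimates (0/9 proved); BetaPertH ⇐ (D1) ∧ (D4) ∧ CAP+tail; G-an2-4 gates asym, D1 and
NE2/3/4.»  [folklore] real analysis (triangle inequality over the continuum values, King's (4.7) by name); no cited fact, no wall binder, no
numerical constant beyond exact rationals × powers of `π`.  NOT summit progress; an input of road P1's Part B (rate `θ = Lc⁻²`) only.

## Setting
A FIXED real fine label `q : Fin D → ℝ` (downstream `q = p + 2π·repZ m`, the SAME vector at both levels) read at two lattice levels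
`0 < N ≤ N′` (downstream `N = Lc^(j+1)`, `N′ = Lc·N`): fine momenta `q/N`, `q/N′`.  The level-`N` symbols are
`N²L_N(q) := Σ_κ N²·4 sin²(q_κ/(2N))` (`= N²·lapSym(q/N) = King1986.latticeSymbol N⁻¹ 0 q`, `SymbolTaylor.sum_sq_mul_four_sin_sq_eq_latticeSymbol`),
the sine vector `s^{(N)}_κ := 2N sin(q_κ/(2N))` (the moduli of `N∂_κ(q/N)` — `SymbolTaylor.dhat_ofRealVec`), the REAL rank-one projector
`P(u)_{κl} := u_κu_l/|u|²` (`Π⊥ = 1 − P`; the complex `Π⊥_m` is its diagonal-phase conjugate, `SymbolProjector.dhat_mul_dflat_div_lapSym_ofRealVec`).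

## What is proved (every `D`; constants explicit)
* (R-L)    `abs_latticeSymbol_two_level_le`: `|N′²L_{N′}(q) − N²L_N(q)| ≤ |q|⁴·(1/(12N²) + 1/(12N′²))` for ALL `q` (no zone hypothesis), and
           `≤ |q|⁴/(6N²)` when `N ≤ N′`;
* (R-Linv) `abs_inv_latticeSymbol_two_level_le`: on the level-`N` zone `|q_κ| ≤ πN` (hence `≤ πN′`), `q ≠ 0`:
           `|(N′²L_{N′})⁻¹ − (N²L_N)⁻¹| ≤ (π²/48)(1/N² + 1/N′²)` — King's (4.7) `latticeSymbol_inv_sub_ref_le` BY NAME at `η = N⁻¹, N′⁻¹`, mass `0`;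
           `inv_latticeSymbol_le`: `(N²L_N)⁻¹ ≤ π²/(4|q|²)`; the squared version (R-Linv²) `≤ (π⁴/96)(1/N² + 1/N′²)/|q|²`;
* (R-P)    `abs_proj_two_level_le`: `|P(s^{(N′)})_{κl} − P(s^{(N)})_{κl}| ≤ |q|²·(1/(6N²) + 1/(6N′²))` (`q ≠ 0`, all `N, N′ > 0`);
* (R-T⊥)   `abs_transverseBlock_two_level_le`: the TRANSVERSE BLOCK `T⊥_N := (δ_{κl} − P(s^{(N)})_{κl})/(2·N²L_N)` satisfies
           `|T⊥_{N′} − T⊥_N| ≤ (π²/32)·(1/N² + 1/N′²)` UNIFORMLY in `q ≠ 0` on the zone (product rule, `|δ − P| ≤ 1`);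
* (R-∂)    first-order structure DISPLAYED (B1): magnitudes are second order — `abs_sineVec_two_level_le`:
           `|2N′ sin(q_κ/(2N′)) − 2N sin(q_κ/(2N))| ≤ |q_κ|³(1/(24N²) + 1/(24N′²))` — while the half-cell PHASES are the only first-order terms:
           `norm_halfPhase_two_level_le`: `‖e^{iq_κ/(2N′)} − e^{iq_κ/(2N)}‖ ≤ |q_κ|·|1/(2N) − 1/(2N′)| ≤ |q_κ|/(2N)`; their cancellation in the
           assembled `kFibClosed` entries is row L11b1 proper (needs `T00`), not claimed here;
* helpers: `abs_mul_sub_mul_le` (product rate), `abs_kronecker_sub_proj_le_one`.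
-/

open Finset
open scoped BigOperators Real

namespace Summit.QuantumFields.BalabanUV.Beta.GAN24.SymbolRate

open Literature.MathematicalPhysics.QuantumFieldTheory.King1986 (latticeSymbol momSq momSq_nonneg latticeSymbol_le
  latticeSymbol_ge_jordan latticeSymbol_inv_sub_ref_le)
open SymbolTaylor (sum_sq_mul_four_sin_sq_eq_latticeSymbol abs_sum_sq_mul_four_sin_sq_sub_momSq_le abs_two_mul_sin_sub_le)
open SymbolProjector (abs_proj_sin_sub_proj_le abs_div_sqrt_momSq_le_one proj_eq_unit_mul_unit)

variable {D : ℕ}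

/-! ## §0 Helpers -/

/-- [folklore] Product rate: `|a′b′ − ab| ≤ |a′ − a|·|b′| + |a|·|b′ − b|`. -/
theorem abs_mul_sub_mul_le (a a' b b' : ℝ) : |a' * b' - a * b| ≤ |a' - a| * |b'| + |a| * |b' - b| := by
  have e : a' * b' - a * b = (a' - a) * b' + a * (b' - b) := by ring
  rw [e]
  exact (abs_add_le _ _).trans (by rw [abs_mul, abs_mul])

/-- [folklore] `1/N′² ≤ 1/N²` for `0 < N ≤ N′`. -/
theorem inv_sq_le_inv_sq {N N' : ℝ} (hN : 0 < N) (hNN' : N ≤ N') : 1 / N' ^ 2 ≤ 1 / N ^ 2 := by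
  have hN' : 0 < N' := lt_of_lt_of_le hN hNN'
  apply one_div_le_one_div_of_le (by positivity)
  exact pow_le_pow_left₀ hN.le hNN' 2

/-! ## §1 (R-L): the Laplacian symbol `N²L_N(q) = latticeSymbol N⁻¹ 0 q` -/

/-- [folklore] `N²L_N(q)` versus its continuum value: `|latticeSymbol N⁻¹ 0 q − |q|²| ≤ |q|⁴/(12N²)` for ALL `q` (`SymbolTaylor`, re-keyed). -/
theorem abs_latticeSymbol_sub_momSq_le {N : ℝ} (hN : N ≠ 0) (q : Fin D → ℝ) :
    |latticeSymbol N⁻¹ 0 q - momSq q| ≤ momSq q ^ 2 / (12 * N ^ 2) := by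
  rw [← sum_sq_mul_four_sin_sq_eq_latticeSymbol hN]
  have h := abs_sum_sq_mul_four_sin_sq_sub_momSq_le hN q
  exact h.1.trans h.2

/-- [folklore] **(R-L) two-level rate of `N²L_m`**: `|N′²L_{N′}(q) − N²L_N(q)| ≤ |q|⁴(1/(12N²) + 1/(12N′²))`, all `q`, `N, N′ ≠ 0`. -/
theorem abs_latticeSymbol_two_level_le {N N' : ℝ} (hN : N ≠ 0) (hN' : N' ≠ 0) (q : Fin D → ℝ) :
    |latticeSymbol N'⁻¹ 0 q - latticeSymbol N⁻¹ 0 q| ≤ momSq q ^ 2 * (1 / (12 * N ^ 2) + 1 / (12 * N' ^ 2)) := by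
  have h1 := abs_latticeSymbol_sub_momSq_le hN q
  have h2 := abs_latticeSymbol_sub_momSq_le hN' q
  calc |latticeSymbol N'⁻¹ 0 q - latticeSymbol N⁻¹ 0 q|
      = |(latticeSymbol N'⁻¹ 0 q - momSq q) - (latticeSymbol N⁻¹ 0 q - momSq q)| := by ring_nf
    _ ≤ |latticeSymbol N'⁻¹ 0 q - momSq q| + |latticeSymbol N⁻¹ 0 q - momSq q| := abs_sub _ _
    _ ≤ momSq q ^ 2 / (12 * N' ^ 2) + momSq q ^ 2 / (12 * N ^ 2) := add_le_add h2 h1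
    _ = momSq q ^ 2 * (1 / (12 * N ^ 2) + 1 / (12 * N' ^ 2)) := by ring

/-- [folklore] (R-L) for `0 < N ≤ N′`: `|N′²L_{N′}(q) − N²L_N(q)| ≤ |q|⁴/(6N²)`. -/
theorem abs_latticeSymbol_two_level_le' {N N' : ℝ} (hN : 0 < N) (hNN' : N ≤ N') (q : Fin D → ℝ) :
    |latticeSymbol N'⁻¹ 0 q - latticeSymbol N⁻¹ 0 q| ≤ momSq q ^ 2 / (6 * N ^ 2) := by
  have hN' : 0 < N' := lt_of_lt_of_le hN hNN'
  refine (abs_latticeSymbol_two_level_le hN.ne' hN'.ne' q).trans ?_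
  have h := inv_sq_le_inv_sq hN hNN'
  have hq : 0 ≤ momSq q ^ 2 := by positivity
  calc momSq q ^ 2 * (1 / (12 * N ^ 2) + 1 / (12 * N' ^ 2))
      = momSq q ^ 2 * ((1 / N ^ 2 + 1 / N' ^ 2) / 12) := by ring
    _ ≤ momSq q ^ 2 * ((1 / N ^ 2 + 1 / N ^ 2) / 12) := by gcongr
    _ = momSq q ^ 2 / (6 * N ^ 2) := by ring

/-! ## §2 (R-Linv): the inverse symbol `(N²L_N)⁻¹` on the zone `|q_κ| ≤ πN` -/

/-- [folklore] Zone transfer: `|q_κ| ≤ πN` and `N ≤ N′` give `|q_κ| ≤ πN′`. -/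
theorem zone_mono {N N' : ℝ} (hNN' : N ≤ N') {q : Fin D → ℝ} (hq : ∀ κ, |q κ| ≤ π * N) (κ : Fin D) : |q κ| ≤ π * N' :=
  (hq κ).trans (mul_le_mul_of_nonneg_left hNN' Real.pi_pos.le)

/-- [folklore] King's zone hypothesis at spacing `η = N⁻¹`: `|N⁻¹·q_κ| ≤ π` from `|q_κ| ≤ πN`. -/
theorem king_zone {N : ℝ} (hN : 0 < N) {q : Fin D → ℝ} (hq : ∀ κ, |q κ| ≤ π * N) (κ : Fin D) : |N⁻¹ * q κ| ≤ π := by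
  rw [abs_mul, abs_inv, abs_of_pos hN, inv_mul_le_iff₀ hN]
  calc |q κ| ≤ π * N := hq κ
    _ = N * π := mul_comm _ _

/-- [folklore] **King (4.7) at level `N`**: `|(N²L_N)⁻¹ − |q|⁻²| ≤ (π²/48)/N²` on the zone, `q ≠ 0` (`latticeSymbol_inv_sub_ref_le` BY NAME). -/
theorem abs_inv_latticeSymbol_sub_inv_momSq_le {N : ℝ} (hN : 0 < N) {q : Fin D → ℝ} (hq : ∀ κ, |q κ| ≤ π * N) (hq0 : 0 < momSq q) :
    |(latticeSymbol N⁻¹ 0 q)⁻¹ - (momSq q)⁻¹| ≤ π ^ 2 / 48 * (1 / N ^ 2) := by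
  have h := latticeSymbol_inv_sub_ref_le (inv_ne_zero hN.ne') le_rfl (king_zone hN hq) hq0
  rw [add_zero] at h
  calc |(latticeSymbol N⁻¹ 0 q)⁻¹ - (momSq q)⁻¹| ≤ π ^ 2 / 48 * N⁻¹ ^ 2 := h
    _ = π ^ 2 / 48 * (1 / N ^ 2) := by rw [inv_pow, one_div]

/-- [folklore] **(R-Linv) two-level rate of `(N²L_m)⁻¹`**: `|(N′²L_{N′})⁻¹ − (N²L_N)⁻¹| ≤ (π²/48)(1/N² + 1/N′²)` on the level-`N` zone,
`0 < N ≤ N′`, `q ≠ 0`. -/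
theorem abs_inv_latticeSymbol_two_level_le {N N' : ℝ} (hN : 0 < N) (hNN' : N ≤ N') {q : Fin D → ℝ}
    (hq : ∀ κ, |q κ| ≤ π * N) (hq0 : 0 < momSq q) :
    |(latticeSymbol N'⁻¹ 0 q)⁻¹ - (latticeSymbol N⁻¹ 0 q)⁻¹| ≤ π ^ 2 / 48 * (1 / N ^ 2 + 1 / N' ^ 2) := by
  have hN' : 0 < N' := lt_of_lt_of_le hN hNN'
  have h1 := abs_inv_latticeSymbol_sub_inv_momSq_le hN hq hq0
  have h2 := abs_inv_latticeSymbol_sub_inv_momSq_le hN' (zone_mono hNN' hq) hq0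
  calc |(latticeSymbol N'⁻¹ 0 q)⁻¹ - (latticeSymbol N⁻¹ 0 q)⁻¹|
      = |((latticeSymbol N'⁻¹ 0 q)⁻¹ - (momSq q)⁻¹) - ((latticeSymbol N⁻¹ 0 q)⁻¹ - (momSq q)⁻¹)| := by ring_nf
    _ ≤ |(latticeSymbol N'⁻¹ 0 q)⁻¹ - (momSq q)⁻¹| + |(latticeSymbol N⁻¹ 0 q)⁻¹ - (momSq q)⁻¹| := abs_sub _ _
    _ ≤ π ^ 2 / 48 * (1 / N' ^ 2) + π ^ 2 / 48 * (1 / N ^ 2) := add_le_add h2 h1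
    _ = π ^ 2 / 48 * (1 / N ^ 2 + 1 / N' ^ 2) := by ring

/-- [folklore] Positivity on the zone: `0 < N²L_N(q)` for `q ≠ 0` (Jordan lower bound `(4/π²)|q|²`, King `latticeSymbol_ge_jordan`). -/
theorem latticeSymbol_pos {N : ℝ} (hN : 0 < N) {q : Fin D → ℝ} (hq : ∀ κ, |q κ| ≤ π * N) (hq0 : 0 < momSq q) :
    0 < latticeSymbol N⁻¹ 0 q := by
  have h := latticeSymbol_ge_jordan (inv_ne_zero hN.ne') 0 (king_zone hN hq)
  have : 0 < 4 / π ^ 2 * momSq q := by positivity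
  linarith

/-- [folklore] `(N²L_N)⁻¹ ≤ π²/(4|q|²)` on the zone (`q ≠ 0`). -/
theorem inv_latticeSymbol_le {N : ℝ} (hN : 0 < N) {q : Fin D → ℝ} (hq : ∀ κ, |q κ| ≤ π * N) (hq0 : 0 < momSq q) :
    (latticeSymbol N⁻¹ 0 q)⁻¹ ≤ π ^ 2 / (4 * momSq q) := by
  have h := latticeSymbol_ge_jordan (inv_ne_zero hN.ne') 0 (king_zone hN hq)
  rw [add_zero] at h
  have hpos : 0 < 4 / π ^ 2 * momSq q := by positivity
  calc (latticeSymbol N⁻¹ 0 q)⁻¹ ≤ (4 / π ^ 2 * momSq q)⁻¹ := by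
        rw [inv_le_inv₀ (lt_of_lt_of_le hpos h) hpos]; exact h
    _ = π ^ 2 / (4 * momSq q) := by
        have hπ : (π : ℝ) ≠ 0 := Real.pi_pos.ne'
        field_simp

/-- [folklore] `0 ≤ (N²L_N)⁻¹`. -/
theorem inv_latticeSymbol_nonneg {N : ℝ} (hN : 0 < N) {q : Fin D → ℝ} (hq : ∀ κ, |q κ| ≤ π * N) (hq0 : 0 < momSq q) :
    0 ≤ (latticeSymbol N⁻¹ 0 q)⁻¹ :=
  inv_nonneg.2 (latticeSymbol_pos hN hq hq0).le

/-- [folklore] **(R-Linv²) two-level rate of `(N²L_m)⁻²`**: `|(N′²L_{N′})⁻² − (N²L_N)⁻²| ≤ (π⁴/96)·(1/N² + 1/N′²)/|q|²` on the level-`N` zone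
(`|x′² − x²| = |x′ − x|·|x′ + x|`, `0 ≤ x, x′ ≤ π²/(4|q|²)`). -/
theorem abs_inv_sq_latticeSymbol_two_level_le {N N' : ℝ} (hN : 0 < N) (hNN' : N ≤ N') {q : Fin D → ℝ}
    (hq : ∀ κ, |q κ| ≤ π * N) (hq0 : 0 < momSq q) :
    |(latticeSymbol N'⁻¹ 0 q)⁻¹ ^ 2 - (latticeSymbol N⁻¹ 0 q)⁻¹ ^ 2|
      ≤ π ^ 4 / 96 * (1 / N ^ 2 + 1 / N' ^ 2) / momSq q := by
  have hN' : 0 < N' := lt_of_lt_of_le hN hNN'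
  set x := (latticeSymbol N⁻¹ 0 q)⁻¹ with hx
  set x' := (latticeSymbol N'⁻¹ 0 q)⁻¹ with hx'
  have hx0 : 0 ≤ x := inv_latticeSymbol_nonneg hN hq hq0
  have hx'0 : 0 ≤ x' := inv_latticeSymbol_nonneg hN' (zone_mono hNN' hq) hq0
  have hxb : x ≤ π ^ 2 / (4 * momSq q) := inv_latticeSymbol_le hN hq hq0
  have hx'b : x' ≤ π ^ 2 / (4 * momSq q) := inv_latticeSymbol_le hN' (zone_mono hNN' hq) hq0
  have hd := abs_inv_latticeSymbol_two_level_le hN hNN' hq hq0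
  have e : x' ^ 2 - x ^ 2 = (x' - x) * (x' + x) := by ring
  rw [e, abs_mul, abs_of_nonneg (by linarith : 0 ≤ x' + x)]
  calc |x' - x| * (x' + x) ≤ π ^ 2 / 48 * (1 / N ^ 2 + 1 / N' ^ 2) * (π ^ 2 / (4 * momSq q) + π ^ 2 / (4 * momSq q)) :=
        mul_le_mul hd (add_le_add hx'b hxb) (by linarith) (by positivity)
    _ = π ^ 4 / 96 * (1 / N ^ 2 + 1 / N' ^ 2) / momSq q := by
        field_simp
        ring

/-! ## §3 (R-P) and (R-T⊥): the real transverse projector and the transverse block -/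

/-- [folklore] **(R-P) two-level rate of the phase-conjugated projector**: with the sine vectors `s^{(N)}_κ = 2N sin(q_κ/(2N))`,
`|P(s^{(N′)})_{κl} − P(s^{(N)})_{κl}| ≤ |q|²(1/(6N²) + 1/(6N′²))` for `q ≠ 0` and all `N, N′ > 0` (no zone hypothesis). -/
theorem abs_proj_two_level_le {N N' : ℝ} (hN : 0 < N) (hN' : 0 < N') {q : Fin D → ℝ} (hq0 : 0 < momSq q) (κ l : Fin D) :
    |(2 * N' * Real.sin (q κ / (2 * N'))) * (2 * N' * Real.sin (q l / (2 * N')))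
          / momSq (fun i => 2 * N' * Real.sin (q i / (2 * N')))
        - (2 * N * Real.sin (q κ / (2 * N))) * (2 * N * Real.sin (q l / (2 * N)))
          / momSq (fun i => 2 * N * Real.sin (q i / (2 * N)))|
      ≤ momSq q * (1 / (6 * N ^ 2) + 1 / (6 * N' ^ 2)) := by
  have h1 := abs_proj_sin_sub_proj_le hN hq0 κ l
  have h2 := abs_proj_sin_sub_proj_le hN' hq0 κ l
  rw [abs_sub_comm] at h1
  calc _ ≤ _ := abs_sub_le _ (q κ * q l / momSq q) _
    _ ≤ momSq q / (6 * N' ^ 2) + momSq q / (6 * N ^ 2) := add_le_add h2 h1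
    _ = momSq q * (1 / (6 * N ^ 2) + 1 / (6 * N' ^ 2)) := by ring

/-- [folklore] The transverse-projector entries are bounded by one: `|δ_{κl} − P(u)_{κl}| ≤ 1` for every real `u` (also `u = 0`). -/
theorem abs_kronecker_sub_proj_le_one {ι : Type*} [Fintype ι] [DecidableEq ι] (u : ι → ℝ) (κ l : ι) :
    |(if κ = l then (1 : ℝ) else 0) - u κ * u l / momSq u| ≤ 1 := by
  rw [proj_eq_unit_mul_unit]
  have hκ := abs_div_sqrt_momSq_le_one u κ
  have hl := abs_div_sqrt_momSq_le_one u l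
  set a := u κ / Real.sqrt (momSq u)
  set b := u l / Real.sqrt (momSq u)
  by_cases h : κ = l
  · subst h
    rw [if_pos rfl]
    have hb2 : b * b ≤ 1 := by
      have := mul_le_one₀ hl (abs_nonneg b) hl
      rwa [abs_mul_abs_self] at this
    have hb0 : 0 ≤ b * b := mul_self_nonneg b
    rw [abs_le]; constructor <;> linarith
  · rw [if_neg h, zero_sub, abs_neg, abs_mul]
    exact mul_le_one₀ hκ (abs_nonneg _) hl

/-- [folklore] **(R-T⊥) two-level rate of the transverse block** `T⊥_N := (δ_{κl} − P(s^{(N)})_{κl})·(N²L_N)⁻¹/2`: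
`|T⊥_{N′} − T⊥_N| ≤ (π²/32)(1/N² + 1/N′²)`, UNIFORMLY in `q ≠ 0` on the level-`N` zone, `0 < N ≤ N′`
(product rule: `|ΔP|·(N′²L′)⁻¹/2 ≤ |q|²(…/6)·π²/(8|q|²)` and `|δ − P|·|Δ(N²L)⁻¹|/2 ≤ (π²/96)(…)`). -/
theorem abs_transverseBlock_two_level_le {N N' : ℝ} (hN : 0 < N) (hNN' : N ≤ N') {q : Fin D → ℝ}
    (hq : ∀ κ, |q κ| ≤ π * N) (hq0 : 0 < momSq q) (κ l : Fin D) :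
    |((if κ = l then (1 : ℝ) else 0)
          - (2 * N' * Real.sin (q κ / (2 * N'))) * (2 * N' * Real.sin (q l / (2 * N')))
              / momSq (fun i => 2 * N' * Real.sin (q i / (2 * N')))) * ((latticeSymbol N'⁻¹ 0 q)⁻¹ / 2)
      - ((if κ = l then (1 : ℝ) else 0)
          - (2 * N * Real.sin (q κ / (2 * N))) * (2 * N * Real.sin (q l / (2 * N)))
              / momSq (fun i => 2 * N * Real.sin (q i / (2 * N)))) * ((latticeSymbol N⁻¹ 0 q)⁻¹ / 2)|
      ≤ π ^ 2 / 32 * (1 / N ^ 2 + 1 / N' ^ 2) := by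
  have hN' : 0 < N' := lt_of_lt_of_le hN hNN'
  set P' := (2 * N' * Real.sin (q κ / (2 * N'))) * (2 * N' * Real.sin (q l / (2 * N')))
              / momSq (fun i => 2 * N' * Real.sin (q i / (2 * N'))) with hP'
  set P := (2 * N * Real.sin (q κ / (2 * N))) * (2 * N * Real.sin (q l / (2 * N)))
              / momSq (fun i => 2 * N * Real.sin (q i / (2 * N))) with hP
  set δ := (if κ = l then (1 : ℝ) else 0) with hδ
  set x := (latticeSymbol N⁻¹ 0 q)⁻¹ with hx
  set x' := (latticeSymbol N'⁻¹ 0 q)⁻¹ with hx'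
  -- ingredients
  have hΔP : |(δ - P') - (δ - P)| ≤ momSq q * (1 / (6 * N ^ 2) + 1 / (6 * N' ^ 2)) := by
    have h := abs_proj_two_level_le hN hN' hq0 κ l
    rw [← hP', ← hP] at h
    calc |(δ - P') - (δ - P)| = |P' - P| := by rw [show (δ - P') - (δ - P) = -(P' - P) by ring, abs_neg]
      _ ≤ _ := h
  have hB1 : |δ - P| ≤ 1 := by
    rw [hδ, hP]; exact abs_kronecker_sub_proj_le_one (fun i => 2 * N * Real.sin (q i / (2 * N))) κ l
  have hx'b : |x' / 2| ≤ π ^ 2 / (8 * momSq q) := by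
    rw [abs_of_nonneg (by have := inv_latticeSymbol_nonneg hN' (zone_mono hNN' hq) hq0; positivity)]
    have := inv_latticeSymbol_le hN' (zone_mono hNN' hq) hq0
    calc x' / 2 ≤ π ^ 2 / (4 * momSq q) / 2 := by gcongr
      _ = π ^ 2 / (8 * momSq q) := by ring
  have hΔx : |x' / 2 - x / 2| ≤ π ^ 2 / 96 * (1 / N ^ 2 + 1 / N' ^ 2) := by
    have h := abs_inv_latticeSymbol_two_level_le hN hNN' hq hq0
    rw [← hx, ← hx'] at h
    rw [show x' / 2 - x / 2 = (x' - x) / 2 by ring, abs_div, abs_two]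
    linarith
  -- product rule
  have hmain := abs_mul_sub_mul_le (δ - P) (δ - P') (x / 2) (x' / 2)
  have hq0' : 0 < momSq q := hq0
  calc |(δ - P') * (x' / 2) - (δ - P) * (x / 2)|
      ≤ |(δ - P') - (δ - P)| * |x' / 2| + |δ - P| * |x' / 2 - x / 2| := hmain
    _ ≤ momSq q * (1 / (6 * N ^ 2) + 1 / (6 * N' ^ 2)) * (π ^ 2 / (8 * momSq q)) + 1 * (π ^ 2 / 96 * (1 / N ^ 2 + 1 / N' ^ 2)) :=
        add_le_add (mul_le_mul hΔP hx'b (abs_nonneg _) (by positivity)) (mul_le_mul hB1 hΔx (abs_nonneg _) zero_le_one)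
    _ = π ^ 2 / 32 * (1 / N ^ 2 + 1 / N' ^ 2) := by
        field_simp
        ring

/-! ## §4 (R-∂): the forward symbol `N∂_κ(q/N)` — second-order magnitudes, first-order phases -/

/-- [folklore] **(R-∂) magnitudes are second order**: the sine-vector components at two levels differ by
`|2N′ sin(q_κ/(2N′)) − 2N sin(q_κ/(2N))| ≤ |q_κ|³(1/(24N²) + 1/(24N′²))` (all `q_κ`, `N, N′ > 0`). -/
theorem abs_sineVec_two_level_le {N N' : ℝ} (hN : 0 < N) (hN' : 0 < N') (x : ℝ) :
    |2 * N' * Real.sin (x / (2 * N')) - 2 * N * Real.sin (x / (2 * N))| ≤ |x| ^ 3 * (1 / (24 * N ^ 2) + 1 / (24 * N' ^ 2)) := by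
  have h1 := abs_two_mul_sin_sub_le hN x
  have h2 := abs_two_mul_sin_sub_le hN' x
  rw [abs_sub_comm] at h1
  calc _ ≤ _ := abs_sub_le _ x _
    _ ≤ |x| ^ 3 / (24 * N' ^ 2) + |x| ^ 3 / (24 * N ^ 2) := add_le_add h2 h1
    _ = |x| ^ 3 * (1 / (24 * N ^ 2) + 1 / (24 * N' ^ 2)) := by ring

/-- [folklore] **(R-∂) the half-cell phases are first order** (B1: the ONLY first-order terms of the T-block symbols):
`‖e^{ix/(2N′)} − e^{ix/(2N)}‖ ≤ |x|·|1/(2N′) − 1/(2N)|` (Lipschitz bound of `t ↦ e^{it}`). -/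
theorem norm_halfPhase_two_level_le {N N' : ℝ} (x : ℝ) :
    ‖Complex.exp (Complex.I * (x / (2 * N') : ℝ)) - Complex.exp (Complex.I * (x / (2 * N) : ℝ))‖
      ≤ |x| * |1 / (2 * N') - 1 / (2 * N)| := by
  have h : ‖Complex.exp (Complex.I * (x / (2 * N') : ℝ)) - Complex.exp (Complex.I * (x / (2 * N) : ℝ))‖
      = ‖Complex.exp (Complex.I * ((x / (2 * N') - x / (2 * N) : ℝ) : ℂ)) - 1‖ := by
    have e : Complex.exp (Complex.I * (x / (2 * N') : ℝ))
        = Complex.exp (Complex.I * (x / (2 * N) : ℝ)) * Complex.exp (Complex.I * ((x / (2 * N') - x / (2 * N) : ℝ) : ℂ)) := by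
      rw [← Complex.exp_add]; congr 1; push_cast; ring
    rw [e, ← mul_sub_one, norm_mul, Complex.norm_exp_I_mul_ofReal, one_mul]
  rw [h]
  refine (Real.norm_exp_I_mul_ofReal_sub_one_le).trans ?_
  rw [Real.norm_eq_abs, show x / (2 * N') - x / (2 * N) = x * (1 / (2 * N') - 1 / (2 * N)) by ring, abs_mul]

/-- [folklore] For `0 < N ≤ N′` the phase discrepancy is at most `|x|/(2N)`. -/
theorem norm_halfPhase_two_level_le' {N N' : ℝ} (hN : 0 < N) (hNN' : N ≤ N') (x : ℝ) :
    ‖Complex.exp (Complex.I * (x / (2 * N') : ℝ)) - Complex.exp (Complex.I * (x / (2 * N) : ℝ))‖ ≤ |x| / (2 * N) := by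
  have hN' : 0 < N' := lt_of_lt_of_le hN hNN'
  refine (norm_halfPhase_two_level_le x).trans ?_
  have h1 : 0 ≤ 1 / (2 * N) - 1 / (2 * N') := by
    rw [sub_nonneg]; exact one_div_le_one_div_of_le (by positivity) (by linarith)
  have h2 : |1 / (2 * N') - 1 / (2 * N)| = 1 / (2 * N) - 1 / (2 * N') := by
    rw [abs_sub_comm]; exact abs_of_nonneg h1
  rw [h2]
  have h3 : 1 / (2 * N) - 1 / (2 * N') ≤ 1 / (2 * N) := by
    have : 0 ≤ 1 / (2 * N') := by positivity
    linarith
  calc |x| * (1 / (2 * N) - 1 / (2 * N')) ≤ |x| * (1 / (2 * N)) := mul_le_mul_of_nonneg_left h3 (abs_nonneg x)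
    _ = |x| / (2 * N) := by ring

end Summit.QuantumFields.BalabanUV.Beta.GAN24.SymbolRate
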